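import Literature.MathematicalPhysics.QuantumFieldTheory.Balaban1983to89.B5Prop11Plancherel

/-!
# `Balaban1983to89.B5Eq129FreeResolventKernelMonotone` — T. Bałaban, *Propagators and renormalization transformations for lattice gauge
# theories. I*, Commun. Math. Phys. **95** (1984) 17–40 [Balaban1984PropagatorsI] (1.29) p. 23 (the free lattice operators on the finite torus
# `T′_η`): **THE FREE RESOLVENT KERNEL `k = (L₀ + m)⁻¹δ₀` ON `Π_μ ℤ∕N_μ` IS EVEN IN EVERY COORDINATE AND DECREASES IN `|x_ν|` AWAY FROM THE
# SOURCE UP TO THE ANTIPODE, AT EVERY TRANSVERSE POSITION — by a REFLECTING MINIMUM PRINCIPLE (no Fourier analysis, no Bessel functions)**;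
# first of three files typing the (K∇) letter VALUE of the pub-balaban NE9 chain's storey J (row L13 of `t4/ROUTES-NE9.md`): the ∇-row
# `Σ_x|k(x+e_ν) − k(x)| ≤ 2∕√(m² + 4mt²)` of the flat massive resolvent (planner sheet P-J-1, `t4-ne9-idea-1` g121∕g122; capstone
# `B5Eq129FreeResolventGradientRow`)

statement-level skeleton of published theorems with citation tags; proofs where landed; nothing here is a claim about the Yang–Mills mass gap

CITATION HEADER (lean-in-tree rule).  Audit cell `pub-balaban`, sub-cell `t4`, BINDER row NE9; filed by NE9 crux-team LEAF PROVER 05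
(`b2b-balaban-t4-ne9-formalise-leaf-05`, gen 80).  The OBJECT is [Balaban1984PropagatorsI] (1.29) p. 23's free lattice Laplacian on the finite
torus, in the encoding of the OWNER's `B5Eq129FreeResolventSupBound` (`B5Prop11Plancherel.Tor N = Π_μ ℤ∕N_μ`, `unitVec`, the stencil
`Σ_ν t²[(φ x − φ(x−e_ν)) + (φ x − φ(x+e_ν))] + m·φ x = ψ x` as a HYPOTHESIS on `φ`; no `def`).  The CONTENT is [folklore] lattice analysis
(discrete maximum principle with an antisymmetric boundary; [DodziukMathai2006] Lemma 1.1 is the `H = univ` case).  Nothing of [B5′] is asserted.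

WHAT IS PROVED (sorry-free; proof lane — 0 `def`).
* §1 **`nonneg_on_of_supersolution_reflecting`** (generic finite graph, coupling `c ≥ 0`, mass `m > 0`: a supersolution on `H` whose outside
  neighbours carry `−u` or `0` is `≥ 0` on `H`); `eq_of_resolvent_eq` (UNIQUENESS), `nonneg_of_resolvent_nonneg` (POSITIVITY).
* §2 **`kernel_reflect`**: `k(…, −x_ν, …) = k(x)` (the stencil commutes with the coordinate reflection; uniqueness).
* §3 **`kernel_sub_unitVec_nonneg`**: `N_ν = M + M′`, `M ≤ M′ ≤ M + 1`, `x_ν ∈ [1, M]` ⟹ `k(x − e_ν) ≥ k(x)` (the dipole `k(· − e_ν) − k` is a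
  supersolution on the half-torus `{1 ≤ x_ν ≤ M}` with reflecting boundary); **`dipole_sign_on_fibre`**: on every fibre `{x_ν = s}` the dipole
  has ONE sign (`≥ 0` on `[1, M]`, `≤ 0` by antisymmetry about the bond midpoint on `{0} ∪ [M′+1, N_ν)`, `= 0` on the odd antipode).
HONEST SCOPE.  Free (`U = 1`) scalar stencil only — the sign argument uses reflection symmetry and does NOT transfer to a covariant `Δ(U)`
with curvature (storey J keeps (K∇) flat by design).  ONE letter of ONE un-opened storey of row L13; NOT the ∇-line of [Balaban1985BackgroundPropagators]
(3.42), NOT Tier P, NOT NE9 (cell pub-balaban: NE9 NOT PRINTED ∕ NOT PROVED; «NE9 ⇐ the named binders»; row WALLED ON A MODEL (O-NE9-1; #5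
UNRULED); spine PROVED 0∕9; rung (B)+1 finite T⁴ — NOT infinite volume, NOT mass gap, NOT BetaPertH, NOT Clay).  HONEST DEPENDENCY: continuum YM
on T⁴ ⇐ BetaPertH ∧ nine spine estimates (0/9 proved); BetaPertH ⇐ (D1) ∧ (D4) ∧ CAP+tail; G-an2-4 gates asym, D1 and NE2/3/4.  NEW file importing
`B5Prop11Plancherel` only; nothing modified.  Net new unproved facts: 0.
-/

noncomputable section

open scoped BigOperators

namespace Literature.MathematicalPhysics.QuantumFieldTheory.Balaban1983to89.B5Eq129FreeResolventKernelMonotone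

open B5Prop11Plancherel (Tor unitVec)

/-! ## §1 The reflecting minimum principle on a finite graph; uniqueness of the resolvent equation -/

/-- **REFLECTING MINIMUM PRINCIPLE.**  On a finite vertex set with nearest-neighbour maps `dn i, up i`, coupling `c ≥ 0` and mass `m > 0`:
if `u` is a supersolution on `H` (`0 ≤ Σ_i c[(u x − u(dn i x)) + (u x − u(up i x))] + m·u x` for `x ∈ H`) and every neighbour of a point
`x ∈ H` lying OUTSIDE `H` carries the value `−u x` or `0` (antisymmetric ∕ absorbing boundary), then `u ≥ 0` on `H` (at a minimiser
`x₀ ∈ H` with `u x₀ < 0` every bracket is `≤ 0` and `m·u x₀ < 0`).  The positivity-preserving property of `(L₀ + m)⁻¹`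
([DodziukMathai2006] Lemma 1.1) is the case `H = univ`. [cite: DodziukMathai2006, Lemma 1.1 §1] -/
theorem nonneg_on_of_supersolution_reflecting {V ι : Type*} [Fintype V] [Fintype ι] (dn up : ι → V → V)
    {c m : ℝ} (hc : 0 ≤ c) (hm : 0 < m) (H : Set V) (u : V → ℝ)
    (hsup : ∀ x ∈ H, 0 ≤ ∑ i, c * ((u x - u (dn i x)) + (u x - u (up i x))) + m * u x)
    (hdn : ∀ x ∈ H, ∀ i, dn i x ∉ H → (u (dn i x) = -u x ∨ u (dn i x) = 0))
    (hup : ∀ x ∈ H, ∀ i, up i x ∉ H → (u (up i x) = -u x ∨ u (up i x) = 0)) :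
    ∀ x ∈ H, 0 ≤ u x := by
  classical
  intro x₁ hx₁
  by_contra hux₁
  have hux₁ : u x₁ < 0 := lt_of_not_ge hux₁
  set S : Finset V := Finset.univ.filter (fun x => x ∈ H) with hS
  have hx₁S : x₁ ∈ S := by simp [hS, hx₁]
  obtain ⟨x₀, hx₀S, hmin⟩ := Finset.exists_min_image S u ⟨x₁, hx₁S⟩
  have hx₀ : x₀ ∈ H := by simpa [hS] using hx₀S
  have hu₀ : u x₀ < 0 := lt_of_le_of_lt (hmin x₁ hx₁S) hux₁
  have hnb : ∀ y, (y ∉ H → (u y = -u x₀ ∨ u y = 0)) → u x₀ ≤ u y := by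
    intro y hy
    by_cases hyH : y ∈ H
    · exact hmin y (by simpa [hS] using hyH)
    · rcases hy hyH with h | h
      · rw [h]; linarith
      · rw [h]; exact hu₀.le
  have hsum : ∑ i, c * ((u x₀ - u (dn i x₀)) + (u x₀ - u (up i x₀))) ≤ 0 := by
    refine Finset.sum_nonpos fun i _ => mul_nonpos_iff.mpr (Or.inl ⟨hc, ?_⟩)
    have h1 := hnb (dn i x₀) (hdn x₀ hx₀ i)
    have h2 := hnb (up i x₀) (hup x₀ hx₀ i)
    linarith
  have h0 := hsup x₀ hx₀
  have hmu : m * u x₀ < 0 := mul_neg_of_pos_of_neg hm hu₀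
  linarith

/-- The stencil is linear: the bracket of a difference is the difference of the brackets. [folklore] -/
private theorem stencil_sub {V ι : Type*} [Fintype ι] (dn up : ι → V → V) (c m : ℝ) (a b : V → ℝ) (x : V) :
    ∑ i, c * (((a x - b x) - (a (dn i x) - b (dn i x))) + ((a x - b x) - (a (up i x) - b (up i x)))) + m * (a x - b x) =
      (∑ i, c * ((a x - a (dn i x)) + (a x - a (up i x))) + m * a x) -
        (∑ i, c * ((b x - b (dn i x)) + (b x - b (up i x))) + m * b x) := by
  have h : ∀ i, c * (((a x - b x) - (a (dn i x) - b (dn i x))) + ((a x - b x) - (a (up i x) - b (up i x)))) =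
      c * ((a x - a (dn i x)) + (a x - a (up i x))) - c * ((b x - b (dn i x)) + (b x - b (up i x))) := fun i => by ring
  simp only [h, Finset.sum_sub_distrib]
  ring

/-- **UNIQUENESS for the resolvent equation `(L₀ + m)φ = ψ` on a finite graph** (`c ≥ 0`, `m > 0`): two solutions with the same data
coincide — the reflecting minimum principle on `H = univ` applied to `φ₂ − φ₁` and `φ₁ − φ₂`. [cite: DodziukMathai2006, Lemma 1.1 §1] -/
theorem eq_of_resolvent_eq {V ι : Type*} [Fintype V] [Fintype ι] (dn up : ι → V → V) {c m : ℝ} (hc : 0 ≤ c) (hm : 0 < m)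
    {φ₁ φ₂ ψ : V → ℝ} (h₁ : ∀ x, ∑ i, c * ((φ₁ x - φ₁ (dn i x)) + (φ₁ x - φ₁ (up i x))) + m * φ₁ x = ψ x)
    (h₂ : ∀ x, ∑ i, c * ((φ₂ x - φ₂ (dn i x)) + (φ₂ x - φ₂ (up i x))) + m * φ₂ x = ψ x) : φ₁ = φ₂ := by
  have key : ∀ (a b : V → ℝ), (∀ x, ∑ i, c * ((a x - a (dn i x)) + (a x - a (up i x))) + m * a x = ψ x) →
      (∀ x, ∑ i, c * ((b x - b (dn i x)) + (b x - b (up i x))) + m * b x = ψ x) → ∀ x, 0 ≤ a x - b x := by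
    intro a b ha hb
    have h := nonneg_on_of_supersolution_reflecting dn up hc hm Set.univ (fun x => a x - b x)
      (fun x _ => by rw [stencil_sub dn up c m a b x, ha x, hb x, sub_self]) (fun x _ i h => (h (Set.mem_univ _)).elim)
      (fun x _ i h => (h (Set.mem_univ _)).elim)
    exact fun x => h x (Set.mem_univ _)
  funext x
  have := key φ₁ φ₂ h₁ h₂ x
  have := key φ₂ φ₁ h₂ h₁ x
  linarith

/-- **POSITIVITY of the resolvent**: `(L₀ + m)φ = ψ ≥ 0` ⟹ `φ ≥ 0`. [cite: DodziukMathai2006, Lemma 1.1 §1] -/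
theorem nonneg_of_resolvent_nonneg {V ι : Type*} [Fintype V] [Fintype ι] (dn up : ι → V → V) {c m : ℝ} (hc : 0 ≤ c) (hm : 0 < m)
    {φ ψ : V → ℝ} (h : ∀ x, ∑ i, c * ((φ x - φ (dn i x)) + (φ x - φ (up i x))) + m * φ x = ψ x) (hψ : ∀ x, 0 ≤ ψ x) (x : V) :
    0 ≤ φ x :=
  nonneg_on_of_supersolution_reflecting dn up hc hm Set.univ φ (fun y _ => by rw [h y]; exact hψ y)
    (fun _ _ _ h => (h (Set.mem_univ _)).elim) (fun _ _ _ h => (h (Set.mem_univ _)).elim) x (Set.mem_univ _)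

/-! ## §2 The flat torus: lattice steps and single-coordinate reflections -/

variable {d : ℕ} (N : Fin d → ℕ)

/-- the ν-th coordinate of `x + e_ν`. [folklore] -/
private theorem add_unitVec_self (x : Tor N) (ν : Fin d) : (x + unitVec N ν) ν = x ν + 1 := by
  simp [unitVec]

/-- the other coordinates of `x + e_ν`. [folklore] -/
private theorem add_unitVec_ne (x : Tor N) {ν μ : Fin d} (h : μ ≠ ν) : (x + unitVec N ν) μ = x μ := by
  simp [unitVec, Pi.single_eq_of_ne h]

/-- the ν-th coordinate of `x − e_ν`. [folklore] -/
private theorem sub_unitVec_self (x : Tor N) (ν : Fin d) : (x - unitVec N ν) ν = x ν - 1 := by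
  simp [unitVec]

/-- the other coordinates of `x − e_ν`. [folklore] -/
private theorem sub_unitVec_ne (x : Tor N) {ν μ : Fin d} (h : μ ≠ ν) : (x - unitVec N ν) μ = x μ := by
  simp [unitVec, Pi.single_eq_of_ne h]

/-- `R_ν(x + e_ν) = R_ν x − e_ν` for the reflection `R_ν x = (…, −x_ν, …)`. [folklore] -/
private theorem reflect_add_unitVec (x : Tor N) (ν : Fin d) :
    Function.update (x + unitVec N ν) ν (-(x + unitVec N ν) ν) = Function.update x ν (-x ν) - unitVec N ν := by
  funext κ
  by_cases h : κ = ν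
  · subst h
    rw [Function.update_self, Pi.sub_apply, Function.update_self, add_unitVec_self]
    simp [unitVec]; ring
  · rw [Function.update_of_ne h, Pi.sub_apply, Function.update_of_ne h, Pi.add_apply]
    simp [unitVec, Pi.single_eq_of_ne h]

/-- `R_ν(x − e_ν) = R_ν x + e_ν`. [folklore] -/
private theorem reflect_sub_unitVec (x : Tor N) (ν : Fin d) :
    Function.update (x - unitVec N ν) ν (-(x - unitVec N ν) ν) = Function.update x ν (-x ν) + unitVec N ν := by
  funext κ
  by_cases h : κ = ν
  · subst h
    rw [Function.update_self, Pi.add_apply, Function.update_self, sub_unitVec_self]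
    simp [unitVec]; ring
  · rw [Function.update_of_ne h, Pi.add_apply, Function.update_of_ne h, Pi.sub_apply]
    simp [unitVec, Pi.single_eq_of_ne h]

/-- `R_ν(x + e_μ) = R_ν x + e_μ` for `μ ≠ ν`. [folklore] -/
private theorem reflect_add_unitVec_ne (x : Tor N) {ν μ : Fin d} (h : μ ≠ ν) :
    Function.update (x + unitVec N μ) ν (-(x + unitVec N μ) ν) = Function.update x ν (-x ν) + unitVec N μ := by
  funext κ
  by_cases hκ : κ = ν
  · subst hκ
    simp only [Function.update_self, Pi.add_apply]
    simp [unitVec, Pi.single_eq_of_ne (Ne.symm h)]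
  · rw [Function.update_of_ne hκ, Pi.add_apply, Pi.add_apply, Function.update_of_ne hκ]

/-- `R_ν(x − e_μ) = R_ν x − e_μ` for `μ ≠ ν`. [folklore] -/
private theorem reflect_sub_unitVec_ne (x : Tor N) {ν μ : Fin d} (h : μ ≠ ν) :
    Function.update (x - unitVec N μ) ν (-(x - unitVec N μ) ν) = Function.update x ν (-x ν) - unitVec N μ := by
  funext κ
  by_cases hκ : κ = ν
  · subst hκ
    simp only [Function.update_self, Pi.sub_apply]
    simp [unitVec, Pi.single_eq_of_ne (Ne.symm h)]
  · rw [Function.update_of_ne hκ, Pi.sub_apply, Pi.sub_apply, Function.update_of_ne hκ]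

/-- `R_ν` is an involution. [folklore] -/
private theorem reflect_reflect (x : Tor N) (ν : Fin d) :
    Function.update (Function.update x ν (-x ν)) ν (-(Function.update x ν (-x ν)) ν) = x := by
  funext κ
  by_cases hκ : κ = ν
  · subst hκ; rw [Function.update_self, Function.update_self, neg_neg]
  · rw [Function.update_of_ne hκ, Function.update_of_ne hκ]

/-- `R_ν x = 0 ↔ x = 0`. [folklore] -/
private theorem reflect_eq_zero_iff (x : Tor N) (ν : Fin d) : Function.update x ν (-x ν) = 0 ↔ x = 0 := by
  constructor
  · intro h
    have := reflect_reflect N x ν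
    rw [h] at this
    rw [← this]
    funext κ
    by_cases hκ : κ = ν
    · subst hκ; simp
    · rw [Function.update_of_ne hκ, Pi.zero_apply]
  · rintro rfl
    funext κ
    by_cases hκ : κ = ν
    · subst hκ; simp
    · rw [Function.update_of_ne hκ]

/-- bookkeeping: a step then a translate is a translate then a step. [folklore] -/
private theorem sub_sub_unitVec_comm (x e : Tor N) (μ : Fin d) : x - unitVec N μ - e = x - e - unitVec N μ := sub_right_comm x _ e

/-- bookkeeping: a forward step then a translate is a translate then a forward step. [folklore] -/
private theorem add_unitVec_sub_comm (x e : Tor N) (μ : Fin d) : x + unitVec N μ - e = x - e + unitVec N μ := add_sub_right_comm x _ e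

/-- `x − e_ν − e_ν = R_ν x` when `x_ν = 1`. [folklore] -/
private theorem sub_sub_eq_reflect_of_eq_one (x : Tor N) (ν : Fin d) (h : x ν = 1) :
    x - unitVec N ν - unitVec N ν = Function.update x ν (-x ν) := by
  funext κ
  by_cases hκ : κ = ν
  · subst hκ; rw [sub_unitVec_self, sub_unitVec_self, Function.update_self, h]; ring
  · rw [sub_unitVec_ne N _ hκ, sub_unitVec_ne N _ hκ, Function.update_of_ne hκ]

/-- `R_ν(x + e_ν) = x − e_ν` when `x_ν = M` and `2M = 0` in `ℤ∕N_ν`. [folklore] -/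
private theorem reflect_add_eq_sub_of_even (x : Tor N) (ν : Fin d) (M : ℕ) (h : x ν = M) (h2 : (M : ZMod (N ν)) + M = 0) :
    Function.update (x + unitVec N ν) ν (-(x + unitVec N ν) ν) = x - unitVec N ν := by
  funext κ
  by_cases hκ : κ = ν
  · subst hκ; rw [Function.update_self, add_unitVec_self, sub_unitVec_self, h]; linear_combination -h2
  · rw [Function.update_of_ne hκ, add_unitVec_ne N _ hκ, sub_unitVec_ne N _ hκ]

/-- `R_ν(x + e_ν) = x` when `x_ν = M` and `2M + 1 = 0` in `ℤ∕N_ν`. [folklore] -/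
private theorem reflect_add_eq_self_of_odd (x : Tor N) (ν : Fin d) (M : ℕ) (h : x ν = M) (h2 : (M : ZMod (N ν)) + M + 1 = 0) :
    Function.update (x + unitVec N ν) ν (-(x + unitVec N ν) ν) = x := by
  funext κ
  by_cases hκ : κ = ν
  · subst hκ; rw [Function.update_self, add_unitVec_self, h]; linear_combination -h2
  · rw [Function.update_of_ne hκ, add_unitVec_ne N _ hκ]

variable [∀ μ, NeZero (N μ)]

/-- **THE RESOLVENT KERNEL IS EVEN IN EVERY COORDINATE**: if `(L₀ + m)k = δ₀` on the torus `Π_μ ℤ∕N_μ` (flat stencil with weight `t²`,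
mass `m > 0`), then `k(…, −x_ν, …) = k(x)` — `k ∘ R_ν` solves the same equation (the stencil is `R_ν`-invariant, `R_ν 0 = 0`), uniqueness.
[cite: Balaban1984PropagatorsI, (1.29) p.23] -/
theorem kernel_reflect (t : ℝ) {m : ℝ} (hm : 0 < m) {k : Tor N → ℝ}
    (hk : ∀ x, ∑ ν, t ^ 2 * ((k x - k (x - unitVec N ν)) + (k x - k (x + unitVec N ν))) + m * k x = if x = 0 then 1 else 0)
    (ν : Fin d) (x : Tor N) : k (Function.update x ν (-x ν)) = k x := by
  have h := eq_of_resolvent_eq (V := Tor N) (ι := Fin d) (fun μ y => y - unitVec N μ) (fun μ y => y + unitVec N μ)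
    (sq_nonneg t) hm (φ₁ := fun y => k (Function.update y ν (-y ν))) (φ₂ := k) (ψ := fun y => if y = 0 then (1 : ℝ) else 0)
    ?_ hk
  · exact congrFun h x
  intro y
  have hy := hk (Function.update y ν (-y ν))
  simp only [reflect_eq_zero_iff N y ν] at hy
  rw [← hy]
  congr 1
  refine Finset.sum_congr rfl fun μ _ => ?_
  by_cases hμ : μ = ν
  · subst hμ
    rw [reflect_sub_unitVec, reflect_add_unitVec]
    ring
  · rw [reflect_sub_unitVec_ne N y hμ, reflect_add_unitVec_ne N y hμ]

/-! ## §3 The dipole `k(· − e_ν) − k`: the kernel decreases in `|x_ν|` up to the antipode -/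

/-- **THE SIGN OF THE DIPOLE (reflection minimum principle on the half-torus).**  Let `(L₀ + m)k = δ₀` on `Π_μ ℤ∕N_μ` (weight `t²`, `m > 0`),
fix a direction `ν` and split the period `N_ν = M + M′` with `M ≤ M′ ≤ M + 1` (`M = ⌊N_ν∕2⌋`).  Then for every site `x` whose ν-coordinate
(read in `[0, N_ν)`) lies in `[1, M]`: `k(x − e_ν) ≥ k(x)` — the kernel DECREASES in `|x_ν|` away from the source up to the antipode, at EVERY
transverse position.  Proof: the dipole `u = k(· − e_ν) − k` solves `(L₀ + m)u = δ_{e_ν} − δ₀ ≥ 0` on `H = {1 ≤ x_ν ≤ M}`; the bonds leaving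
`H` end at `x_ν = 0` (where `u = −u(reflected point)` by the evenness `kernel_reflect`) or at `x_ν = M + 1` (where `u = −u` if `N_ν = 2M`, `u = 0`
if `N_ν = 2M + 1`); `nonneg_on_of_supersolution_reflecting`.  No heat kernel, no Bessel functions.
[cite: Balaban1984PropagatorsI, (1.29) p.23] -/
theorem kernel_sub_unitVec_nonneg (t : ℝ) {m : ℝ} (hm : 0 < m) {k : Tor N → ℝ}
    (hk : ∀ x, ∑ ν, t ^ 2 * ((k x - k (x - unitVec N ν)) + (k x - k (x + unitVec N ν))) + m * k x = if x = 0 then 1 else 0)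
    (ν : Fin d) (M M' : ℕ) (hMM' : M + M' = N ν) (hle : M ≤ M') (hle' : M' ≤ M + 1)
    (x : Tor N) (h1 : 1 ≤ (x ν).val) (h2 : (x ν).val ≤ M) : 0 ≤ k (x - unitVec N ν) - k x := by
  -- the period in direction `ν` is at least `2`
  have hn2 : 2 ≤ N ν := by have := ZMod.val_lt (x ν); omega
  haveI : Fact (1 < N ν) := ⟨by omega⟩
  have hval1 : (1 : ZMod (N ν)).val = 1 := ZMod.val_one _
  set H : Set (Tor N) := {y | 1 ≤ (y ν).val ∧ (y ν).val ≤ M} with hH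
  refine nonneg_on_of_supersolution_reflecting (V := Tor N) (ι := Fin d) (fun μ y => y - unitVec N μ) (fun μ y => y + unitVec N μ)
    (sq_nonneg t) hm H (fun y => k (y - unitVec N ν) - k y) ?_ ?_ ?_ x ⟨h1, h2⟩
  · -- supersolution on `H`: the stencil of the dipole is `δ_{e_ν} − δ₀`, and `0 ∉ H`
    intro y hy
    have hy0 : y ≠ 0 := by
      rintro rfl
      have h01 := hy.1
      simp at h01
    have e := stencil_sub (fun μ z => z - unitVec N μ) (fun μ z => z + unitVec N μ) (t ^ 2) m
      (fun z => k (z - unitVec N ν)) k y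
    rw [e]
    have h1' := hk (y - unitVec N ν)
    have h2' := hk y
    simp only [sub_sub_unitVec_comm N y (unitVec N ν), add_unitVec_sub_comm N y (unitVec N ν)] at *
    rw [h1', h2', if_neg hy0, sub_zero]
    split_ifs <;> norm_num
  · -- backward bonds leaving `H`: only in direction `ν`, from `x_ν = 1` to `x_ν = 0`
    intro y hy μ hμ
    by_cases hμν : μ = ν
    · subst hμν
      have hyv : (y μ).val = 1 := by
        by_contra hne
        apply hμ
        have hv : ((y - unitVec N μ) μ).val = (y μ).val - 1 := by
          rw [sub_unitVec_self, ZMod.val_sub (by rw [hval1]; exact hy.1), hval1]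
        refine ⟨?_, ?_⟩ <;> rw [hv] <;> [skip; exact le_trans (Nat.sub_le _ _) hy.2]
        have := hy.1; omega
      have hy1 : y μ = 1 := by
        rw [← ZMod.natCast_zmod_val (y μ), hyv, Nat.cast_one]
      left
      rw [sub_sub_eq_reflect_of_eq_one N y μ hy1, kernel_reflect N t hm hk μ y]
      ring
    · exact absurd ⟨by rw [sub_unitVec_ne N y (Ne.symm hμν)]; exact hy.1, by rw [sub_unitVec_ne N y (Ne.symm hμν)]; exact hy.2⟩ hμ
  · -- forward bonds leaving `H`: only in direction `ν`, from `x_ν = M` to `x_ν = M + 1`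
    intro y hy μ hμ
    by_cases hμν : μ = ν
    · subst hμν
      have hyv : (y μ).val = M := by
        by_contra hne
        apply hμ
        have hlt : (y μ).val + 1 < N μ := by have := hy.2; omega
        have hv : ((y + unitVec N μ) μ).val = (y μ).val + 1 := by
          rw [add_unitVec_self, ZMod.val_add_of_lt (by rwa [hval1]), hval1]
        refine ⟨by rw [hv]; omega, by rw [hv]; have := hy.2; omega⟩
      have hyM : y μ = (M : ZMod (N μ)) := by rw [← ZMod.natCast_zmod_val (y μ), hyv]
      have hn0 : ((M + M' : ℕ) : ZMod (N μ)) = 0 := by rw [hMM']; exact ZMod.natCast_self _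
      rcases Nat.eq_or_lt_of_le hle with hEq | hLt
      · -- even period: the forward neighbour reflects onto the backward one
        left
        have h2 : (M : ZMod (N μ)) + M = 0 := by rw [← hEq] at hn0; exact_mod_cast hn0
        have hR := reflect_add_eq_sub_of_even N y μ M hyM h2
        have hk' := kernel_reflect N t hm hk μ (y + unitVec N μ)
        rw [hR] at hk'
        simp only [add_sub_cancel_right]
        rw [hk']; ring
      · -- odd period: the forward neighbour is a fixed point of the reflection
        right
        have hM' : M' = M + 1 := by omega
        have h2 : (M : ZMod (N μ)) + M + 1 = 0 := by rw [hM'] at hn0; exact_mod_cast hn0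
        have hR := reflect_add_eq_self_of_odd N y μ M hyM h2
        have hk' := kernel_reflect N t hm hk μ (y + unitVec N μ)
        rw [hR] at hk'
        simp only [add_sub_cancel_right]
        rw [hk']; ring
    · exact absurd ⟨by rw [add_unitVec_ne N y (Ne.symm hμν)]; exact hy.1, by rw [add_unitVec_ne N y (Ne.symm hμν)]; exact hy.2⟩ hμ

/-- the dipole is odd under `y ↦ R_ν y + e_ν` (reflection about the bond midpoint). [folklore] -/
private theorem dipole_antisymm (t : ℝ) {m : ℝ} (hm : 0 < m) {k : Tor N → ℝ}
    (hk : ∀ x, ∑ ν, t ^ 2 * ((k x - k (x - unitVec N ν)) + (k x - k (x + unitVec N ν))) + m * k x = if x = 0 then 1 else 0)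
    (ν : Fin d) (y : Tor N) :
    k (Function.update y ν (-y ν) + unitVec N ν - unitVec N ν) - k (Function.update y ν (-y ν) + unitVec N ν) =
      -(k (y - unitVec N ν) - k y) := by
  rw [add_sub_cancel_right, kernel_reflect N t hm hk ν y, ← kernel_reflect N t hm hk ν (_ + unitVec N ν),
    reflect_add_unitVec, reflect_reflect]
  ring

/-- **THE SIGN OF THE DIPOLE ON EVERY FIBRE** (`N_ν ≥ 2`, `N_ν = M + M′`, `M ≤ M′ ≤ M + 1`): reading `v = x_ν ∈ [0, N_ν)`,
`k(x − e_ν) − k(x) ≥ 0` for `v ∈ [1, M]`, `≤ 0` for `v = 0` or `v ≥ M′ + 1` (antisymmetry about the bond midpoint), and `= 0` on the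
antipodal fibre `v = M + 1` of an odd period — so on each fibre `{x_ν = s}` the dipole has ONE sign. [cite: Balaban1984PropagatorsI, (1.29) p.23] -/
theorem dipole_sign_on_fibre (t : ℝ) {m : ℝ} (hm : 0 < m) {k : Tor N → ℝ}
    (hk : ∀ x, ∑ ν, t ^ 2 * ((k x - k (x - unitVec N ν)) + (k x - k (x + unitVec N ν))) + m * k x = if x = 0 then 1 else 0)
    (ν : Fin d) (hn : 2 ≤ N ν) (M M' : ℕ) (hMM' : M + M' = N ν) (hle : M ≤ M') (hle' : M' ≤ M + 1) (s : ZMod (N ν)) :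
    (∀ x : Tor N, x ν = s → 0 ≤ k (x - unitVec N ν) - k x) ∨ (∀ x : Tor N, x ν = s → k (x - unitVec N ν) - k x ≤ 0) := by
  haveI : Fact (1 < N ν) := ⟨by omega⟩
  have hval1 : (1 : ZMod (N ν)).val = 1 := ZMod.val_one _
  have hv := ZMod.val_lt s
  rcases (show (1 ≤ s.val ∧ s.val ≤ M) ∨ (s.val = 0 ∨ (M' + 1 ≤ s.val)) ∨ (s.val = M + 1 ∧ M' = M + 1) by omega)
    with h | h | h
  · exact Or.inl fun x hx => kernel_sub_unitVec_nonneg N t hm hk ν M M' hMM' hle hle' x (hx ▸ h.1) (hx ▸ h.2)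
  · -- reflect about the bond midpoint: the partner fibre `1 − s` lies in `[1, M]`
    right
    intro x hx
    have hval : 1 ≤ (1 - s).val ∧ (1 - s).val ≤ M := by
      rcases h with h0 | hbig
      · rw [(ZMod.val_eq_zero s).1 h0, sub_zero, hval1]; omega
      · have hs1 : (s - 1).val = s.val - 1 := by rw [ZMod.val_sub (by rw [hval1]; omega), hval1]
        have hne : s - 1 ≠ 0 := by
          intro h0; have := (ZMod.val_eq_zero (s - 1)).2 h0; omega
        rw [show (1 : ZMod (N ν)) - s = -(s - 1) by ring, ZMod.neg_val, if_neg hne, hs1]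
        omega
    have hcoord : (Function.update x ν (-x ν) + unitVec N ν) ν = 1 - s := by
      rw [add_unitVec_self, Function.update_self, hx]; ring
    have hpos := kernel_sub_unitVec_nonneg N t hm hk ν M M' hMM' hle hle' (Function.update x ν (-x ν) + unitVec N ν)
      (hcoord ▸ hval.1) (hcoord ▸ hval.2)
    rw [dipole_antisymm N t hm hk ν x] at hpos
    linarith
  · -- the antipodal fibre of an odd period: `R_ν x = x − e_ν`, so the dipole vanishes
    left
    intro x hx
    have hn0 : ((M + M' : ℕ) : ZMod (N ν)) = 0 := by rw [hMM']; exact ZMod.natCast_self _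
    have hxs : x ν = ((M + 1 : ℕ) : ZMod (N ν)) := by rw [hx, ← ZMod.natCast_zmod_val s, h.1]
    have hR : Function.update x ν (-x ν) = x - unitVec N ν := by
      funext κ
      by_cases hκ : κ = ν
      · subst hκ
        rw [Function.update_self, sub_unitVec_self, hxs]
        rw [h.2] at hn0; push_cast at hn0 ⊢
        linear_combination -hn0
      · rw [Function.update_of_ne hκ, sub_unitVec_ne N _ hκ]
    rw [← hR, kernel_reflect N t hm hk ν x, sub_self]

end Literature.MathematicalPhysics.QuantumFieldTheory.Balaban1983to89.B5Eq129FreeResolventKernelMonotone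

end
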